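import Literature.Probability.LatticeModels.CoarseCellMixingDefectsChainAdm
import Literature.Probability.LatticeModels.CoarseCellMixingDefectsMarkovBlocks
import Literature.Probability.LatticeModels.CoarseCellMixingDefectsClusterReach
import Literature.Probability.LatticeModels.CoarseCellMixingPeierls
import HarnessLib

/-!
# Coarse-cell mixing with defects: the influence of one bad-cluster term (block-Markov case)

Companion ("theorems only") file of the coarse-cell defect series. The expansion around
Peierls-rare bad cells decomposes an observable `Ψ` of the seed cells `Sd` according to the bad
cluster `K` attached to `Sd` (`CoarseCellMixingDefectsClusters.badCluster`, linking range `1`,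
universe all cells). This file bounds the boundary influence of ONE term `Ψ · 1_{badCluster = K}`
for a NEAR cluster shape `K` (no cell within coarse distance `1` of `core ∪ K` is a source cell),
for a block-Markov specification (`HasBlockLeak cell γ 0 r`) with the kernel-uniform Peierls bound:

* resample the block `A` of volume sites whose cell lies in `core ∪ K` (consistency); the inner
  expectation `ψ_K` is bounded by `λ q^{|K|}` (`UniformKernelPeierls`: on the event, every cell
  adjacent to `K` outside the block is good), VANISHES unless the ring cells forced good by the
  event are good, and — block-Markov — reads only the ring
  `R = ((Sd ∪ N₁(core ∪ K)) ∖ (core ∪ K)) ∩ {volume cells}`;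
* the chain rule under the admissibility region (`multiCell_influence_adm_of_abs_le`) then gives
  `|γ_Λ(Ψ 1_{E_K})(ζ) - γ_Λ(Ψ 1_{E_K})(ζ')| ≤ 2 λ q^{|K|} Σ_{y ∈ R} δ y`
  (`clusterTerm_influence_le`).

Also: the signed form of exact block locality (`kernel_integral_eq_of_hasBlockLeak_zero_of_abs_le`)
and the measurability / locality of the events `{badCluster = K}`.

## References

* J. van den Berg, C. Maes, *Disagreement percolation in the study of Markov fields*,
  Ann. Probab. 22 (1994), §2.
* R. L. Dobrushin, S. B. Shlosman, *Completely analytical interactions: constructive description*,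
  J. Stat. Phys. 46 (1987); H.-O. Georgii, *Gibbs Measures and Phase Transitions* (2011), §8.2.
-/

noncomputable section

open _root_.MeasureTheory
open scoped ENNReal

namespace Literature.Probability.LatticeModels

variable {d : ℕ} {μc : Fin d → ℕ} {V S : Type*} [MeasurableSpace S]

/-! ### Signed form of exact block locality -/

/-- **Exact locality of block kernels, signed observables**: under `HasBlockLeak cell γ 0 r`, for
a cell-union `A`, two exteriors agreeing on every site off `A` whose cell is within coarse distance
`1` of a cell of `A`, and a bounded measurable `f` reading only `A` and agreeing sites,
`γ_A f(σ) = γ_A f(σ')` (affine rescaling to `[0,1]`). [folklore] -/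
theorem kernel_integral_eq_of_hasBlockLeak_zero_of_abs_le [Fintype V] {cell : V → CoarseIdx μc}
    {γ : Specification V S} (hγ : IsSpecification γ) {r : ℝ}
    (hBL : HasBlockLeak cell γ 0 r) (A : Finset V) (hA : ∀ v w, cell v = cell w → v ∈ A → w ∈ A)
    (σ σ' : V → S)
    (hagree : ∀ v, v ∉ A → (∃ w ∈ A, cdist (cell w) (cell v) ≤ 1) → σ v = σ' v)
    {f : (V → S) → ℝ} (hf : Measurable f) {M : ℝ} (hfM : ∀ τ, |f τ| ≤ M)
    (hdep : DependsOn f {v | v ∈ A ∨ σ v = σ' v}) :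
    ∫ τ, f τ ∂(γ A σ) = ∫ τ, f τ ∂(γ A σ') := by
  haveI := hγ.isProbability A σ
  haveI := hγ.isProbability A σ'
  have hM : 0 ≤ M := (abs_nonneg _).trans (hfM σ)
  rcases hM.eq_or_lt with hM0 | hMpos
  · have hf0 : ∀ τ, f τ = 0 := fun τ => abs_nonpos_iff.1 (hM0 ▸ hfM τ)
    simp [hf0]
  · set P : (V → S) → ℝ := fun τ => (f τ / M + 1) / 2 with hP
    have hPm : Measurable P := ((hf.div_const M).add_const 1).div_const 2
    have hP01 : ∀ τ, 0 ≤ P τ ∧ P τ ≤ 1 := fun τ => by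
      have h := abs_le.1 (hfM τ)
      have hlo : -1 ≤ f τ / M := by rw [le_div_iff₀ hMpos]; linarith [h.1]
      have hhi : f τ / M ≤ 1 := by rw [div_le_iff₀ hMpos]; linarith [h.2]
      simp only [hP]; constructor <;> linarith
    have hPdep : DependsOn P {v | v ∈ A ∨ σ v = σ' v} := fun τ τ' h => by
      simp only [hP, hdep h]
    have hPeq := kernel_integral_eq_of_hasBlockLeak_zero hγ hBL A hA σ σ' hagree hPm hP01 hPdep
    have hfP : ∀ τ, f τ = M * (2 * P τ - 1) := fun τ => by
      simp only [hP]; field_simp; ring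
    have hPi : ∀ η, Integrable P (γ A η) := fun η => by
      haveI := hγ.isProbability A η
      exact DobrushinMetric.integrable_of_abs_le' hPm (M := 1) fun τ => by
        rw [abs_of_nonneg (hP01 τ).1]; exact (hP01 τ).2
    have hint : ∀ η, IsProbabilityMeasure (γ A η) →
        ∫ τ, f τ ∂(γ A η) = M * (2 * ∫ τ, P τ ∂(γ A η) - 1) := by
      intro η _
      simp_rw [hfP]
      rw [integral_const_mul, integral_sub ((hPi η).const_mul 2) (integrable_const 1),
        integral_const_mul]
      simp
    rw [hint σ inferInstance, hint σ' inferInstance, hPeq]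

/-! ### The events `{badCluster = K}` -/

section Events

variable (good : CoarseIdx μc → Set (V → S)) (Sd K : Finset (CoarseIdx μc))

/-- The event "the bad cluster attached to the seed `Sd` (linking range `1`, all cells) is
exactly `K`". [folklore] -/
def clusterEvent : Set (V → S) := {σ | badCluster good 1 Finset.univ Sd σ = K}

variable {good Sd K}

omit [MeasurableSpace S] in
/-- **Rectangle form of the cluster event**: for a cluster shape `K`, `σ ∈ clusterEvent good Sd K`
iff every cell of `K` is bad and every cell outside `K` that is a seed cell or adjacent to `K`
is good. [folklore] -/
theorem mem_clusterEvent_iff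
    (hK : IsClusterShape (fun x y : CoarseIdx μc => cdist x y ≤ 1) Sd K) (σ : V → S) :
    σ ∈ clusterEvent good Sd K ↔
      (∀ c ∈ K, σ ∉ good c) ∧ ∀ c, c ∉ K → (c ∈ Sd ∨ ∃ k ∈ K, cdist k c ≤ 1) → σ ∈ good c := by
  rw [clusterEvent, Set.mem_setOf_eq, badCluster_eq_iff hK (Finset.subset_univ K)]
  simp only [Finset.mem_univ, forall_true_left]

omit [MeasurableSpace S] in
/-- The cluster event only reads the cells `K ∪ Sd ∪ N₁(K)` (cell-locality of `good`).
[folklore] -/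
theorem mem_clusterEvent_iff_of_agree {cell : V → CoarseIdx μc}
    (hgl : ∀ (c : CoarseIdx μc) (σ τ : V → S), (∀ v, cell v = c → σ v = τ v) →
      (σ ∈ good c ↔ τ ∈ good c))
    (hK : IsClusterShape (fun x y : CoarseIdx μc => cdist x y ≤ 1) Sd K) {σ τ : V → S}
    (h : ∀ v, (cell v ∈ K ∨ cell v ∈ Sd ∨ ∃ k ∈ K, cdist k (cell v) ≤ 1) → σ v = τ v) :
    σ ∈ clusterEvent good Sd K ↔ τ ∈ clusterEvent good Sd K := by
  rw [mem_clusterEvent_iff hK, mem_clusterEvent_iff hK]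
  have e1 : ∀ c ∈ K, (σ ∈ good c ↔ τ ∈ good c) := fun c hc =>
    hgl c σ τ fun v hv => h v (Or.inl (hv ▸ hc))
  have e2 : ∀ c, (c ∈ Sd ∨ ∃ k ∈ K, cdist k c ≤ 1) → (σ ∈ good c ↔ τ ∈ good c) := fun c hc =>
    hgl c σ τ fun v hv => h v (Or.inr (hv ▸ hc))
  constructor
  · rintro ⟨hbad, hgood⟩
    exact ⟨fun c hc hτ => hbad c hc ((e1 c hc).2 hτ), fun c hcK hc => (e2 c hc).1 (hgood c hcK hc)⟩
  · rintro ⟨hbad, hgood⟩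
    exact ⟨fun c hc hσ => hbad c hc ((e1 c hc).1 hσ), fun c hcK hc => (e2 c hc).2 (hgood c hcK hc)⟩

omit [MeasurableSpace S] in
/-- The cluster event of a cluster shape is measurable (a finite Boolean combination of the
measurable cell events). [folklore] -/
theorem measurableSet_clusterEvent [MeasurableSpace (V → S)]
    (hgm : ∀ c, MeasurableSet (good c))
    (hK : IsClusterShape (fun x y : CoarseIdx μc => cdist x y ≤ 1) Sd K) :
    MeasurableSet (clusterEvent good Sd K : Set (V → S)) := by
  classical
  have h : (clusterEvent good Sd K : Set (V → S)) =
      (⋂ c ∈ K, (good c)ᶜ) ∩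
        ⋂ c ∈ (Finset.univ.filter fun c : CoarseIdx μc =>
          c ∉ K ∧ (c ∈ Sd ∨ ∃ k ∈ K, cdist k c ≤ 1)), good c := by
    ext σ
    rw [mem_clusterEvent_iff hK]
    simp only [Set.mem_inter_iff, Set.mem_iInter, Set.mem_compl_iff, Finset.mem_filter,
      Finset.mem_univ, true_and, and_imp]
  rw [h]
  exact (Finset.measurableSet_biInter K fun c _ => (hgm c).compl).inter
    (Finset.measurableSet_biInter _ fun c _ => hgm c)

end Events

/-! ### The influence of one near cluster term -/

/-- **Influence of one near bad-cluster term (block-Markov case).** Let `γ` be a block-Markov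
specification (`HasBlockLeak cell γ 0 r`) with the kernel-uniform Peierls bound at level `q`, and
suppose the single-cell influence bound `δ` holds for every cell-union volume and every
`F`-admissible pair. Let `Λ'` be a cell-union volume with an `F`-admissible pair `(ζ, ζ')`, `core`
a set of cells, `Sd` a set of seed cells all lying in `Λ'` and off `F`, such that every `Λ'`-cell
adjacent to `core` outside `core ∪ K` is a seed cell, and `K` a cluster shape for `Sd` whose
`1`-neighbourhood together with that of `core` avoids `F`. Then for a measurable observable `Ψ` of
the seed cells with `|Ψ| ≤ λ`,
`|γ_{Λ'}(Ψ · 1_{badCluster = K})(ζ) - γ_{Λ'}(Ψ · 1_{badCluster = K})(ζ')| ≤ 2 λ q^{|K|} Σ_{y ∈ R} δ y`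
with `R` the `Λ'`-cells of `(Sd ∪ N₁(core ∪ K)) ∖ (core ∪ K)`: glue the frozen sites to `ζ`,
resample the block of `Λ'`-sites of `core ∪ K` (consistency), bound the inner expectation by
`λ q^{|K|}` (Peierls) and note it vanishes unless the ring is good and is ring-local
(block-Markov), then apply the chain rule `multiCell_influence_adm_of_abs_le`. [folklore] -/
theorem clusterTerm_influence_le [Fintype V] [DecidableEq V] {cell : V → CoarseIdx μc}
    {γ : Specification V S} (hγ : IsSpecification γ) {good : CoarseIdx μc → Set (V → S)}
    (hgl : ∀ (c : CoarseIdx μc) (σ τ : V → S), (∀ v, cell v = c → σ v = τ v) →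
      (σ ∈ good c ↔ τ ∈ good c))
    (hgm : ∀ c, MeasurableSet (good c)) {r : ℝ} (hBL : HasBlockLeak cell γ 0 r)
    {q : ℝ} (hq : 0 ≤ q) (hUKP : UniformKernelPeierls cell γ good q)
    (F : Finset (CoarseIdx μc)) {δ : CoarseIdx μc → ℝ} (hδ : ∀ x, 0 ≤ δ x)
    (hR : ∀ (Λ : Finset V), (∀ v w, cell v = cell w → v ∈ Λ → w ∈ Λ) →
      ∀ (x : CoarseIdx μc) (g : (V → S) → ℝ), Measurable g → (∀ σ, 0 ≤ g σ ∧ g σ ≤ 1) →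
      DependsOn g {v | cell v = x} →
      ∀ ζ ζ' : V → S, AdmRegion cell good F Λ ζ ζ' →
        |∫ σ, g σ ∂(γ Λ ζ) - ∫ σ, g σ ∂(γ Λ ζ')| ≤ δ x)
    (Λ' : Finset V) (hΛ' : ∀ v w, cell v = cell w → v ∈ Λ' → w ∈ Λ')
    (ζ ζ' : V → S) (hadm : AdmRegion cell good F Λ' ζ ζ')
    (core Sd K : Finset (CoarseIdx μc))
    (hKshape : IsClusterShape (fun x y : CoarseIdx μc => cdist x y ≤ 1) Sd K)
    (hnear : ∀ c : CoarseIdx μc, (∃ k ∈ core ∪ K, cdist k c ≤ 1) → c ∉ F)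
    (hSdF : ∀ c ∈ Sd, c ∉ F) (hSdΛ : ∀ c ∈ Sd, ∀ v, cell v = c → v ∈ Λ')
    (hring : ∀ c : CoarseIdx μc, c ∉ core → c ∉ K → (∃ p ∈ core, cdist p c ≤ 1) →
      (∀ v, cell v = c → v ∈ Λ') → c ∈ Sd)
    (Ψ : (V → S) → ℝ) (hΨm : Measurable Ψ) {lam : ℝ} (hΨb : ∀ σ, |Ψ σ| ≤ lam)
    (hΨdep : DependsOn Ψ {v | cell v ∈ Sd}) :
    |∫ σ, Ψ σ * (clusterEvent good Sd K).indicator 1 σ ∂(γ Λ' ζ) -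
        ∫ σ, Ψ σ * (clusterEvent good Sd K).indicator 1 σ ∂(γ Λ' ζ')| ≤
      2 * lam * q ^ K.card *
        ∑ y ∈ ((Sd ∪ fatten Finset.univ (core ∪ K) 1) \ (core ∪ K)).filter
            (fun c => ∀ v, cell v = c → v ∈ Λ'), δ y := by
  classical
  set E : Set (V → S) := clusterEvent good Sd K with hEdef
  have hE : MeasurableSet E := measurableSet_clusterEvent hgm hKshape
  set C : Finset (CoarseIdx μc) := core ∪ K with hCdef
  set A : Finset V := sitesIn cell Λ' C with hAdef
  have hAΛ' : A ⊆ Λ' := sitesIn_subset (cell := cell) Λ' C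
  have hAunion : ∀ v w, cell v = cell w → v ∈ A → w ∈ A := sitesIn_cellUnion (cell := cell) hΛ' C
  set R : Finset (CoarseIdx μc) := ((Sd ∪ fatten Finset.univ C 1) \ C).filter
    (fun c => ∀ v, cell v = c → v ∈ Λ') with hRdef
  have hlam : 0 ≤ lam := (abs_nonneg _).trans (hΨb ζ)
  haveI := hγ.isProbability Λ' ζ
  haveI := hγ.isProbability Λ' ζ'
  -- the glued configurations
  let glue : (V → S) → (V → S) := fun σ v => if v ∈ Λ' then σ v else ζ v
  have hglue_m : Measurable glue := by
    refine measurable_pi_iff.2 fun v => ?_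
    by_cases hv : v ∈ Λ'
    · simp only [glue, hv, if_true]; exact measurable_pi_apply v
    · simp only [glue, hv, if_false]; exact measurable_const
  have hglue_in : ∀ σ v, v ∈ Λ' → glue σ v = σ v := fun σ v hv => by
    simp only [glue, hv, if_true]
  have hglue_out : ∀ σ v, v ∉ Λ' → glue σ v = ζ v := fun σ v hv => by
    simp only [glue, hv, if_false]
  -- the glued integrand
  set G : (V → S) → ℝ := fun σ => Ψ (glue σ) * E.indicator 1 (glue σ) with hGdef
  have hind_m : Measurable (E.indicator (1 : (V → S) → ℝ)) := measurable_const.indicator hE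
  have hGm : Measurable G := (hΨm.comp hglue_m).mul (hind_m.comp hglue_m)
  have hind01 : ∀ τ, 0 ≤ E.indicator (1 : (V → S) → ℝ) τ ∧ E.indicator (1 : (V → S) → ℝ) τ ≤ 1 :=
    fun τ => by by_cases h : τ ∈ E <;> simp [h]
  have hGb : ∀ σ, |G σ| ≤ lam := fun σ => by
    simp only [hGdef]
    rw [abs_mul]
    calc |Ψ (glue σ)| * |E.indicator 1 (glue σ)| ≤ lam * 1 := by
          refine mul_le_mul (hΨb _) ?_ (abs_nonneg _) hlam
          rw [abs_of_nonneg (hind01 _).1]; exact (hind01 _).2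
      _ = lam := mul_one _
  -- `G` depends only on the `Λ'`-sites
  have hGdepΛ : DependsOn G (↑Λ' : Set V) := by
    intro σ σ' h
    have : glue σ = glue σ' := funext fun v => by
      by_cases hv : v ∈ Λ'
      · rw [hglue_in σ v hv, hglue_in σ' v hv]; exact h v hv
      · rw [hglue_out σ v hv, hglue_out σ' v hv]
    simp only [hGdef, this]
  -- the cells read by the cluster event avoid `F`
  have hreadF : ∀ v, (cell v ∈ K ∨ cell v ∈ Sd ∨ ∃ k ∈ K, cdist k (cell v) ≤ 1) → cell v ∉ F := by
    rintro v (h | h | ⟨k, hk, hkv⟩)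
    · exact hnear _ ⟨cell v, Finset.mem_union_right _ h, by rw [cdist_self]; exact Nat.zero_le _⟩
    · exact hSdF _ h
    · exact hnear _ ⟨k, Finset.mem_union_right _ hk, hkv⟩
  -- Step 0: under either kernel the raw integrand equals the glued one
  have hstep0 : ∀ η : V → S, (∀ v, v ∉ Λ' → cell v ∉ F → η v = ζ v) →
      ∫ σ, Ψ σ * E.indicator 1 σ ∂(γ Λ' η) = ∫ σ, G σ ∂(γ Λ' η) := by
    intro η hη
    refine integral_congr_ae ?_
    filter_upwards [hγ.proper Λ' η] with σ hσ
    have hΨeq : Ψ σ = Ψ (glue σ) := hΨdep fun v hv => (hglue_in σ v (hSdΛ _ hv v rfl)).symm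
    have hEeq : σ ∈ E ↔ glue σ ∈ E := by
      refine mem_clusterEvent_iff_of_agree hgl hKshape fun v hv => ?_
      by_cases hvΛ : v ∈ Λ'
      · exact (hglue_in σ v hvΛ).symm
      · rw [hglue_out σ v hvΛ, hσ v hvΛ]
        exact hη v hvΛ (hreadF v hv)
    simp only [hGdef]
    rw [hΨeq]
    congr 1
    by_cases h : σ ∈ E
    · simp only [Set.indicator_of_mem h, Set.indicator_of_mem (hEeq.1 h), Pi.one_apply]
    · simp only [Set.indicator_of_notMem h, Set.indicator_of_notMem (fun h' => h (hEeq.2 h'))]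
  have hζF : ∀ v, v ∉ Λ' → cell v ∉ F → ζ v = ζ v := fun _ _ _ => rfl
  have hζ'F : ∀ v, v ∉ Λ' → cell v ∉ F → ζ' v = ζ v := fun v hv hF => (hadm v hv hF).1.symm
  -- Step 1: consistency, resampling the block `A`
  have hcons : ∀ η, ∫ σ, G σ ∂(γ Λ' η) = ∫ σ, (∫ τ, G τ ∂(γ A σ)) ∂(γ Λ' η) := fun η =>
    (kernel_integral_integral_eq_of_subset hγ hAΛ' η hGm hGb).symm
  -- Step 2: the inner expectation with glued exterior
  set ψ : (V → S) → ℝ := fun σ => ∫ τ, G τ ∂(γ A (glue σ)) with hψdef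
  have hψm : Measurable ψ := (DobrushinShlosman.measurable_windowAvg' hγ A hGm).comp hglue_m
  have hinner : ∀ η : V → S, (∀ v, v ∉ Λ' → cell v ∉ F → η v = ζ v) →
      ∀ σ, (∀ v, v ∉ Λ' → σ v = η v) → ∫ τ, G τ ∂(γ A σ) = ψ σ := by
    intro η hη σ hσ
    simp only [hψdef]
    refine kernel_integral_eq_of_hasBlockLeak_zero_of_abs_le hγ hBL A hAunion σ (glue σ)
      (fun v hvA hnearA => ?_) hGm hGb (hGdepΛ.mono fun v hv => ?_)
    · by_cases hvΛ : v ∈ Λ'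
      · exact (hglue_in σ v hvΛ).symm
      · rw [hglue_out σ v hvΛ, hσ v hvΛ]
        refine hη v hvΛ (hnear _ ?_)
        obtain ⟨w, hw, hwv⟩ := hnearA
        exact ⟨cell w, (mem_sitesIn.1 hw).2, hwv⟩
    · exact Or.inr (hglue_in σ v hv).symm
  -- Step 3a: `ψ` vanishes unless the ring cells forced good by the event are good
  have hψ_zero : ∀ σ : V → S, ∀ c : CoarseIdx μc, c ∉ C → (c ∈ Sd ∨ ∃ k ∈ K, cdist k c ≤ 1) →
      glue σ ∉ good c → ψ σ = 0 := by
    intro σ c hcC hc hbad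
    simp only [hψdef]
    have h : ∀ᵐ τ ∂(γ A (glue σ)), G τ = 0 := by
      filter_upwards [hγ.proper A (glue σ)] with τ hτ
      -- `τ = glue σ` off `A`, in particular on the cell `c`
      have hτc : ∀ v, cell v = c → τ v = glue σ v := fun v hv =>
        hτ v fun hvA => hcC (hv ▸ (mem_sitesIn.1 hvA).2)
      have hgg : glue τ = τ := funext fun v => by
        by_cases hv : v ∈ Λ'
        · exact hglue_in τ v hv
        · rw [hglue_out τ v hv, hτ v fun hvA => hv (hAΛ' hvA), hglue_out σ v hv]
      have hτbad : τ ∉ good c := fun h => hbad ((hgl c τ (glue σ) hτc).1 h)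
      have hτE : τ ∉ E := fun hτE' => by
        have hcK : c ∉ K := fun hcK => hcC (Finset.mem_union_right _ hcK)
        exact hτbad (((mem_clusterEvent_iff hKshape τ).1 hτE').2 c hcK hc)
      simp only [hGdef, hgg, Set.indicator_of_notMem hτE, mul_zero]
    rw [integral_congr_ae h, integral_zero]
  -- Step 3b: the Peierls bound `|ψ| ≤ λ q^{|K|}`
  have hψb : ∀ σ, |ψ σ| ≤ lam * q ^ K.card := by
    intro σ
    haveI := hγ.isProbability A (glue σ)
    by_cases hfrozen : ∃ c ∈ K, ∃ v, cell v = c ∧ v ∉ Λ'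
    · -- a frozen cell in `K` is good (admissibility), so the event is null under the inner kernel
      obtain ⟨c, hcK, v₀, hv₀c, hv₀⟩ := hfrozen
      have hcF : c ∉ F := hnear c ⟨c, Finset.mem_union_right _ hcK, by
        rw [cdist_self]; exact Nat.zero_le _⟩
      have hζc : ζ ∈ good c := by
        have h := (hadm v₀ hv₀ (hv₀c ▸ hcF)).2.1
        rwa [hv₀c] at h
      have h : ∀ᵐ τ ∂(γ A (glue σ)), G τ = 0 := by
        filter_upwards [hγ.proper A (glue σ)] with τ hτ
        have hcout : ∀ v, cell v = c → v ∉ Λ' := fun v hv hvΛ =>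
          hv₀ (hΛ' v v₀ (hv.trans hv₀c.symm) hvΛ)
        have hτc : ∀ v, cell v = c → τ v = ζ v := fun v hv => by
          rw [hτ v fun hvA => hcout v hv (hAΛ' hvA), hglue_out σ v (hcout v hv)]
        have hgg : glue τ = τ := funext fun v => by
          by_cases hv : v ∈ Λ'
          · exact hglue_in τ v hv
          · rw [hglue_out τ v hv, hτ v fun hvA => hv (hAΛ' hvA), hglue_out σ v hv]
        have hτgood : τ ∈ good c := (hgl c τ ζ hτc).2 hζc
        have hτE : τ ∉ E := fun hτE' => ((mem_clusterEvent_iff hKshape τ).1 hτE').1 c hcK hτgood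
        simp only [hGdef, hgg, Set.indicator_of_notMem hτE, mul_zero]
      simp only [hψdef]
      rw [integral_congr_ae h, integral_zero, abs_zero]
      positivity
    · push Not at hfrozen
      -- either some forced-good ring cell is bad (then `ψ σ = 0`) or Peierls applies
      by_cases hgoodring : ∀ c : CoarseIdx μc, c ∉ C → (c ∈ Sd ∨ ∃ k ∈ K, cdist k c ≤ 1) →
          glue σ ∈ good c
      · have hle : |ψ σ| ≤ lam * (γ A (glue σ)).real E := by
          simp only [hψdef]
          have h1 : |∫ τ, G τ ∂(γ A (glue σ))| ≤ ∫ τ, |G τ| ∂(γ A (glue σ)) :=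
            abs_integral_le_integral_abs
          refine h1.trans ?_
          have h2 : ∀ τ, |G τ| ≤ lam * E.indicator 1 (glue τ) := fun τ => by
            simp only [hGdef]
            rw [abs_mul, abs_of_nonneg (hind01 _).1]
            exact mul_le_mul_of_nonneg_right (hΨb _) (hind01 _).1
          have h3 : ∀ᵐ τ ∂(γ A (glue σ)), |G τ| ≤ lam * E.indicator 1 τ := by
            filter_upwards [hγ.proper A (glue σ)] with τ hτ
            have hgg : glue τ = τ := funext fun v => by
              by_cases hv : v ∈ Λ'
              · exact hglue_in τ v hv
              · rw [hglue_out τ v hv, hτ v fun hvA => hv (hAΛ' hvA), hglue_out σ v hv]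
            have := h2 τ
            rwa [hgg] at this
          have hGi : Integrable (fun τ => |G τ|) (γ A (glue σ)) :=
            (DobrushinMetric.integrable_of_abs_le' hGm hGb).abs
          have hIi : Integrable (fun τ => lam * E.indicator (1 : (V → S) → ℝ) τ) (γ A (glue σ)) :=
            ((integrable_const (1 : ℝ)).indicator hE).const_mul lam
          calc ∫ τ, |G τ| ∂(γ A (glue σ)) ≤ ∫ τ, lam * E.indicator 1 τ ∂(γ A (glue σ)) :=
                integral_mono_ae hGi hIi h3
            _ = lam * (γ A (glue σ)).real E := by
                rw [integral_const_mul, integral_indicator_one hE]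
        refine hle.trans (mul_le_mul_of_nonneg_left ?_ hlam)
        -- Peierls on `K`
        have hEsub : E ⊆ {τ : V → S | ∀ c ∈ K, τ ∉ good c} := fun τ hτ =>
          ((mem_clusterEvent_iff hKshape τ).1 hτ).1
        have hnbr : ∀ c ∈ K, ∀ c' : CoarseIdx μc, cdist c c' ≤ 1 →
            (∀ v, cell v = c' → v ∈ A) ∨ glue σ ∈ good c' := by
          intro c hc c' hcc'
          by_cases hc'C : c' ∈ C
          · by_cases hc'Λ : ∀ v, cell v = c' → v ∈ Λ'
            · exact Or.inl fun v hv => mem_sitesIn.2 ⟨hc'Λ v hv, hv ▸ hc'C⟩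
            · -- a frozen cell of the core: good for `ζ = glue σ` there (admissibility)
              right
              push Not at hc'Λ
              obtain ⟨v₀, hv₀c, hv₀⟩ := hc'Λ
              have hc'K : c' ∉ K := fun h => hv₀ (hfrozen c' h v₀ hv₀c)
              have hc'F : c' ∉ F := hnear c' ⟨c', hc'C, by rw [cdist_self]; exact Nat.zero_le _⟩
              have hζc' : ζ ∈ good c' := by
                have h := (hadm v₀ hv₀ (hv₀c ▸ hc'F)).2.1
                rwa [hv₀c] at h
              have hcout : ∀ v, cell v = c' → v ∉ Λ' := fun v hv hvΛ =>
                hv₀ (hΛ' v v₀ (hv.trans hv₀c.symm) hvΛ)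
              exact (hgl c' (glue σ) ζ fun v hv => hglue_out σ v (hcout v hv)).2 hζc'
          · exact Or.inr (hgoodring c' hc'C (Or.inr ⟨c, hc, hcc'⟩))
        have hP := hUKP A hAunion (glue σ) K hnbr
        calc (γ A (glue σ)).real E ≤ (γ A (glue σ)).real {τ | ∀ c ∈ K, τ ∉ good c} :=
              measureReal_mono hEsub
          _ ≤ q ^ K.card := ENNReal.toReal_le_of_le_ofReal (by positivity) hP
      · push Not at hgoodring
        obtain ⟨c, hcC, hc, hbad⟩ := hgoodring
        rw [hψ_zero σ c hcC hc hbad, abs_zero]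
        positivity
  -- Step 3c: `ψ` is ring-local
  have hψdep : DependsOn ψ {v | cell v ∈ R} := by
    intro σ₁ σ₂ h12
    simp only [hψdef]
    refine kernel_integral_eq_of_hasBlockLeak_zero_of_abs_le hγ hBL A hAunion (glue σ₁) (glue σ₂)
      (fun v hvA hnearA => ?_) hGm hGb ?_
    · by_cases hvΛ : v ∈ Λ'
      · rw [hglue_in σ₁ v hvΛ, hglue_in σ₂ v hvΛ]
        refine h12 v (show cell v ∈ R from ?_)
        have hcC : cell v ∉ C := fun h => hvA (mem_sitesIn.2 ⟨hvΛ, h⟩)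
        refine Finset.mem_filter.2 ⟨Finset.mem_sdiff.2 ⟨Finset.mem_union_right _ ?_, hcC⟩,
          fun w hw => hΛ' v w hw.symm hvΛ⟩
        obtain ⟨w, hw, hwv⟩ := hnearA
        exact mem_fatten.2 ⟨Finset.mem_univ _, cell w, (mem_sitesIn.1 hw).2, hwv⟩
      · rw [hglue_out σ₁ v hvΛ, hglue_out σ₂ v hvΛ]
    · -- `G` reads `A` and sites where the two glued exteriors agree
      intro τ τ' hττ'
      have key : ∀ v, v ∈ Λ' → (cell v ∈ K ∨ cell v ∈ Sd ∨ ∃ k ∈ K, cdist k (cell v) ≤ 1) →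
          τ v = τ' v := by
        intro v hvΛ hv
        apply hττ'
        by_cases hcC : cell v ∈ C
        · exact Or.inl (mem_sitesIn.2 ⟨hvΛ, hcC⟩)
        · right
          rw [hglue_in σ₁ v hvΛ, hglue_in σ₂ v hvΛ]
          refine h12 v (show cell v ∈ R from Finset.mem_filter.2
            ⟨Finset.mem_sdiff.2 ⟨?_, hcC⟩, fun w hw => hΛ' v w hw.symm hvΛ⟩)
          rcases hv with h | h | ⟨k, hk, hkv⟩
          · exact absurd (Finset.mem_union_right _ h) hcC
          · exact Finset.mem_union_left _ h
          · exact Finset.mem_union_right _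
              (mem_fatten.2 ⟨Finset.mem_univ _, k, Finset.mem_union_right _ hk, hkv⟩)
      have hΨeq : Ψ (glue τ) = Ψ (glue τ') := hΨdep fun v hv => by
        have hvΛ : v ∈ Λ' := hSdΛ _ hv v rfl
        show glue τ v = glue τ' v
        rw [hglue_in τ v hvΛ, hglue_in τ' v hvΛ]
        exact key v hvΛ (Or.inr (Or.inl hv))
      have hEeq : glue τ ∈ E ↔ glue τ' ∈ E := by
        refine mem_clusterEvent_iff_of_agree hgl hKshape fun v hv => ?_
        by_cases hvΛ : v ∈ Λ'
        · rw [hglue_in τ v hvΛ, hglue_in τ' v hvΛ]; exact key v hvΛ hv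
        · rw [hglue_out τ v hvΛ, hglue_out τ' v hvΛ]
      simp only [hGdef, hΨeq]
      congr 1
      by_cases h : glue τ ∈ E
      · simp only [Set.indicator_of_mem h, Set.indicator_of_mem (hEeq.1 h), Pi.one_apply]
      · simp only [Set.indicator_of_notMem h, Set.indicator_of_notMem (fun h' => h (hEeq.2 h'))]
  -- Step 3d: `ψ` vanishes as soon as a cell of `R` is bad
  have hψ0 : ∀ σ, (∃ y ∈ R, σ ∉ good y) → ψ σ = 0 := by
    rintro σ ⟨y, hyR, hσy⟩
    obtain ⟨hy1, hyΛ⟩ := Finset.mem_filter.1 hyR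
    obtain ⟨hy2, hyC⟩ := Finset.mem_sdiff.1 hy1
    have hycore : y ∉ core := fun h => hyC (Finset.mem_union_left _ h)
    have hyK : y ∉ K := fun h => hyC (Finset.mem_union_right _ h)
    have hy : y ∈ Sd ∨ ∃ k ∈ K, cdist k y ≤ 1 := by
      rcases Finset.mem_union.1 hy2 with h | h
      · exact Or.inl h
      · obtain ⟨-, k, hk, hky⟩ := mem_fatten.1 h
        rcases Finset.mem_union.1 hk with hk' | hk'
        · exact Or.inl (hring y hycore hyK ⟨k, hk', hky⟩ hyΛ)
        · exact Or.inr ⟨k, hk', hky⟩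
    refine hψ_zero σ y hyC hy fun hg => hσy ?_
    exact (hgl y (glue σ) σ fun v hv => hglue_in σ v (hyΛ v hv)).1 hg
  -- Step 4: the chain rule over the ring
  have hRΛ : ∀ y ∈ R, ∀ v, cell v = y → v ∈ Λ' := fun y hy => (Finset.mem_filter.1 hy).2
  have hchain := multiCell_influence_adm_of_abs_le hγ hgl F hδ hR R Λ' hΛ' hRΛ ψ hψm hψb hψdep hψ0
    ζ ζ' hadm
  -- assemble
  have e1 : ∫ σ, Ψ σ * E.indicator 1 σ ∂(γ Λ' ζ) = ∫ σ, ψ σ ∂(γ Λ' ζ) := by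
    rw [hstep0 ζ hζF, hcons ζ]
    refine integral_congr_ae ?_
    filter_upwards [hγ.proper Λ' ζ] with σ hσ
    exact hinner ζ hζF σ hσ
  have e2 : ∫ σ, Ψ σ * E.indicator 1 σ ∂(γ Λ' ζ') = ∫ σ, ψ σ ∂(γ Λ' ζ') := by
    rw [hstep0 ζ' hζ'F, hcons ζ']
    refine integral_congr_ae ?_
    filter_upwards [hγ.proper Λ' ζ'] with σ hσ
    exact hinner ζ' hζ'F σ hσ
  rw [e1, e2]
  calc |∫ σ, ψ σ ∂(γ Λ' ζ) - ∫ σ, ψ σ ∂(γ Λ' ζ')|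
      ≤ 2 * (lam * q ^ K.card) * ∑ y ∈ R, δ y := hchain
    _ = 2 * lam * q ^ K.card * ∑ y ∈ R, δ y := by ring

end Literature.Probability.LatticeModels
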